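import Literature.AlgebraicGeometry.Smoothening.WeakNeronModelPoints
import Literature.AlgebraicGeometry.Smoothening.WeakNeronModelAbelian
import Literature.AlgebraicGeometry.Smoothening.ForestAdmissible
import HarnessLib

/-!
# The weak Néron model for the admissible test rings — arbitrary residue field (BLR 3.5 with 3.6)

Topic: `Literature/AlgebraicGeometry/Smoothening` (Bosch–Lütkebohmert–Raynaud, *Néron Models*,
§3.5 weak Néron models and §3.6: the smoothening and the weak Néron property relative to the
discrete valuation rings `R'` over `R` of ramification index one with separable residue field
extension; M. Artin, *Néron Models*, Lemma (3.6)). The files `WeakNeronModel`,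
`WeakNeronModelSmooth`, `WeakNeronModelAbelian`, `WeakNeronModelPoints` assume the residue field
of `R` perfect and serve ALL test rings; this file removes the perfectness assumption and serves
the **admissible** test rings (`ForestAdmissible.AdmClass`: residue field formally smooth =
separable over that of `R`), using the smoothening process for the admissible class
(`ForestAdmissible.nonempty_smoothening_adm_of_projective`):

* `ProjectiveModel.nonempty_smoothening_chart_adm`, `ProjectiveModel.exists_smooth_lift_of_point_adm`;
* `SmoothChartsP` (smooth charts lifting the `P`-points), `ProjectiveModel.nonempty_smoothCharts_adm`,
  `ProjectiveModel.exists_smoothChart_lift_of_point_adm`;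
* `exists_smoothWeakNeronCharts_adm` — weak Néron models of abelian varieties over any discrete
  valuation ring, for the admissible points;
* `ProjectiveModel.exists_pathOver_point_adm` — the scheme-level form;
* `admClass_of_formallySmooth_map` — a test ring whose residue field map
  `ResidueField R → ResidueField S` is formally smooth is admissible (the hypothesis of the
  `…separablePoints` form of the Néron property, `NeronPropertyFromPoints`).

The proofs are those of the four files with the class threaded through. [folklore]; no named
facts (D-0026).

## References

* S. Bosch, W. Lütkebohmert, M. Raynaud, *Néron Models*, Springer 1990, §3.5, §3.6.
  [BLRNeronModels1990] (Not held; numbers only.)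
* M. Artin, *Néron Models*, in Cornell–Silverman (eds.), *Arithmetic Geometry*, Springer 1986,
  Lemma (3.6) (p. 225). [Artin1986NeronModels]
-/

noncomputable section

open CategoryTheory AlgebraicGeometry IsLocalRing MvPolynomial
open scoped TensorProduct
open Literature.AlgebraicGeometry.Motives

namespace Literature.AlgebraicGeometry.Smoothening

universe u

/-! ### Smooth charts for a class of test rings -/

/-- **A finite family of smooth affine charts capturing the `P`-points of `Spec R[T]/I`**
(`SmoothCharts` for a class `P` of test rings). [folklore] -/
structure SmoothChartsP (R : Type u) [CommRing R] (P : TestClass R) (ϖ : R) {N : ℕ}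
    (I : Ideal (MvPolynomial (Fin N) R)) : Type (u + 1) where
  /-- the index set of the charts -/
  ι : Type u
  /-- there are finitely many charts -/
  [fintype : Fintype ι]
  /-- the numbers of variables of the charts -/
  N' : ι → ℕ
  /-- the ideals of the charts -/
  I' : ∀ j, Ideal (MvPolynomial (Fin (N' j)) R)
  /-- the paths to the charts -/
  path : ∀ j, ForestPath R ϖ I (I' j)
  /-- the charts are smooth over `R` -/
  smooth : ∀ j, Algebra.Smooth R (MvPolynomial (Fin (N' j)) R ⧸ I' j)
  /-- every `P`-point lifts to a point of some chart -/
  lift : ∀ (S : Type u) [CommRing S] [IsDomain S] [IsDiscreteValuationRing S] [Algebra R S],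
    Irreducible (algebraMap R S ϖ) → P S →
      ∀ a : (MvPolynomial (Fin N) R ⧸ I) →ₐ[R] S,
        ∃ (j : ι) (b : (MvPolynomial (Fin (N' j)) R ⧸ I' j) →ₐ[R] S), ∀ x, b ((path j).map x) = a x

attribute [instance] SmoothChartsP.fintype

/-! ### Admissibility from the residue field map -/

section AdmOfMap

variable {R : Type u} [CommRing R] [IsLocalRing R] {S : Type u} [CommRing S] [IsDomain S]
  [IsDiscreteValuationRing S] [Algebra R S]

/-- A test ring over a local ring `R` whose residue field map is formally smooth is admissible for
`π₀ = residue R`. [folklore] -/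
theorem admClass_of_formallySmooth_map [IsLocalHom (algebraMap R S)]
    (h : (ResidueField.map (algebraMap R S)).FormallySmooth) :
    AdmClass (IsLocalRing.residue R) S :=
  ⟨ResidueField.map (algebraMap R S), rfl, h⟩

end AdmOfMap

-- The ideals of the charts of a projective model are obtained by choice; nothing depends on their
-- definition, and unfolding them during unification is expensive.
attribute [local irreducible] ProjectiveModel.chartIdeal

namespace ProjectiveModel

variable {R K : Type u} [CommRing R] [IsDomain R] [IsDiscreteValuationRing R] [Field K] [Algebra R K]
  [IsFractionRing R K] {E : SchemeOver K} (M : ProjectiveModel R K E) {ϖ : R} (hϖ : Irreducible ϖ)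

/-- The admissible class of a discrete valuation ring: through its residue map. -/
local notation "Adm" => AdmClass (IsLocalRing.residue R)

include hϖ in
/-- **Smoothening of the admissible points of the charts of a projective model** of a smooth
integral `K`-scheme over a discrete valuation ring with ARBITRARY residue field (BLR 3.4 Thm. 2
with 3.6 / 3.5, applied to the charts). [folklore] -/
theorem nonempty_smoothening_chart_adm [IsIntegral E.left] [Smooth E.hom]
    (s : Fin (M.n + 1)) : Nonempty (NeronSmootheningP R Adm ϖ (M.chartIdeal s) ⊥) := by
  rcases M.isDomain_or_subsingleton_away s hϖ with hdom | hsub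
  · haveI := hdom
    haveI := M.formallySmooth_away s hϖ
    exact nonempty_smoothening_adm_of_projective (π₀ := IsLocalRing.residue R)
      Ideal.Quotient.mk_surjective (ker_residue_eq_span hϖ) (M.chartIdeal s)
      (Localization.Away (algebraMap R (M.chartRing s) ϖ))
  · haveI := hsub
    exact ⟨(Classical.choice (nonempty_smoothening_of_subsingleton ϖ (M.chartIdeal s)
      (Localization.Away (algebraMap R (M.chartRing s) ϖ)) ⊥)).toP Adm⟩

include hϖ in
/-- **The weak Néron property of the smoothened charts for the admissible points, arbitrary
residue field** (Artin, Lemma (3.6); BLR 3.5 with 3.6). [cite: Artin1986NeronModels, Lemma (3.6) (p. 225)] -/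
theorem exists_smooth_lift_of_point_adm [IsIntegral E.left] [Smooth E.hom]
    (𝒮 : ∀ s : Fin (M.n + 1), NeronSmootheningP R Adm ϖ (M.chartIdeal s) ⊥)
    {S L : Type u} [CommRing S] [IsDomain S] [IsDiscreteValuationRing S] [Field L] [Algebra S L]
    [IsFractionRing S L] [Algebra R S] [Algebra K L] [Algebra R L] [IsScalarTower R S L]
    [IsScalarTower R K L] (hπ : Irreducible (algebraMap R S ϖ)) (hS : AdmClass (IsLocalRing.residue R) S)
    (x : Spec (.of L) ⟶ E.left) (hx : x ≫ E.hom = Spec.map (CommRingCat.ofHom (algebraMap K L))) :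
    ∃ (s : Fin (M.n + 1)) (i : (𝒮 s).ι)
      (a' : (MvPolynomial (Fin ((𝒮 s).N' i)) R ⧸ (𝒮 s).I' i) →ₐ[R] S),
      Spec.map (CommRingCat.ofHom (algebraMap S L)) ≫
          Spec.map (CommRingCat.ofHom (a'.comp ((𝒮 s).path i).map).toRingHom) ≫ M.chart s =
            x ≫ M.gen ∧
        neronDefectOfHom R S a' = 0 ∧
        Algebra.IsSmoothAt R ((maximalIdeal S).comap a'.toRingHom) := by
  obtain ⟨s, a, ha⟩ := M.exists_algHom_of_point (O := S) x hx
  obtain ⟨i, a', ha', hδ⟩ := (𝒮 s).lift S hπ hS a fun z hz => by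
    rw [Ideal.mem_bot.mp hz, map_zero, map_zero]; exact zero_mem _
  have hcomp : a'.comp ((𝒮 s).path i).map = a := AlgHom.ext ha'
  exact ⟨s, i, a', by rw [hcomp]; exact ha, hδ,
    M.isSmoothAt_of_neronDefectOfHom_eq_zero hϖ s ((𝒮 s).path i) hπ a' hδ⟩

include hϖ in
/-- **Smooth charts for the admissible points of a projective model, arbitrary residue field.**
[cite: Artin1986NeronModels, Lemma (3.6) (p. 225) and proof of (3.2) (p. 224)] -/
theorem nonempty_smoothCharts_adm [IsIntegral E.left] [Smooth E.hom]
    (s : Fin (M.n + 1)) : Nonempty (SmoothChartsP R Adm ϖ (M.chartIdeal s)) := by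
  classical
  obtain ⟨𝒯⟩ := M.nonempty_smoothening_chart_adm hϖ s
  -- the smooth loci of the forest charts, as finite unions of smooth basic opens
  have hloc := fun i : 𝒯.ι => exists_finset_smoothLocus_eq R (forestRing M s (𝒯.path i))
  choose t ht hsmooth using hloc
  -- polynomial representatives of the `f ∈ t i`
  refine ⟨{ ι := Σ i : 𝒯.ι, (t i : Set (forestRing M s (𝒯.path i)))
            N' := fun j => 𝒯.N' j.1 + 1
            I' := fun j => Smoothening.chartIdeal (𝒯.I' j.1) (Quotient.out (j.2 : forestRing M s (𝒯.path j.1)))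
            path := fun j => (𝒯.path j.1).openChart _
            smooth := fun j => ?_
            lift := fun S _ _ _ _ hπ hS a => ?_ }⟩
  · -- smoothness of the basic open `D(f)`
    refine smooth_openChart _ _ ?_
    rw [Ideal.Quotient.mk_out]
    exact hsmooth j.1 _ (Finset.mem_coe.mp j.2.2)
  · -- lifting: first to a `δ = 0` point of a forest chart, a smooth point, then to the `D(f)` containing it
    obtain ⟨i, a', ha', hδ⟩ := 𝒯.lift S hπ hS a fun z hz => by
      rw [Ideal.mem_bot.mp hz, map_zero, map_zero]; exact zero_mem _
    have hsm : Algebra.IsSmoothAt R ((maximalIdeal S).comap a'.toRingHom) :=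
      M.isSmoothAt_of_neronDefectOfHom_eq_zero hϖ s (𝒯.path i) hπ a' hδ
    haveI : ((maximalIdeal S).comap a'.toRingHom).IsPrime := Ideal.comap_isPrime _ _
    have hmem : (⟨(maximalIdeal S).comap a'.toRingHom, inferInstance⟩ : PrimeSpectrum (forestRing M s (𝒯.path i))) ∈
        Algebra.smoothLocus R (forestRing M s (𝒯.path i)) := hsm
    rw [ht i, Set.mem_iUnion₂] at hmem
    obtain ⟨f, hf, hfmem⟩ := hmem
    rw [SetLike.mem_coe, PrimeSpectrum.mem_basicOpen] at hfmem
    -- `a'(f)` is a unit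
    have hunit : IsUnit (a' f) := by
      by_contra hu
      exact hfmem ((IsLocalRing.mem_maximalIdeal _).mpr (mem_nonunits_iff.mpr hu))
    have hunit' : IsUnit (a' (Ideal.Quotient.mk (𝒯.I' i) (Quotient.out f))) := by
      rwa [Ideal.Quotient.mk_out]
    refine ⟨⟨i, f, Finset.mem_coe.mpr hf⟩, chartPoint (𝒯.I' i) (Quotient.out f) a' hunit', fun x => ?_⟩
    have h1 := chartPoint_algebraMap (𝒯.I' i) (Quotient.out f) a' hunit' ((𝒯.path i).map x)
    change chartPoint (𝒯.I' i) (Quotient.out f) a' hunit'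
      (algebraMap _ _ (((𝒯.path i).map : M.chartRing s → _) x)) = a x
    rw [h1]
    exact ha' x

omit [IsDomain R] [IsDiscreteValuationRing R] [IsFractionRing R K] in
/-- **The weak Néron property in smooth charts for a class of test rings.**
[cite: Artin1986NeronModels, Lemma (3.6) (p. 225)] -/
theorem exists_smoothChart_lift_of_pointP (P : TestClass R) [IsIntegral E.left] [Smooth E.hom]
    (𝒞 : ∀ s : Fin (M.n + 1), SmoothChartsP R P ϖ (M.chartIdeal s))
    {S L : Type u} [CommRing S] [IsDomain S] [IsDiscreteValuationRing S] [Field L] [Algebra S L]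
    [IsFractionRing S L] [Algebra R S] [Algebra K L] [Algebra R L] [IsScalarTower R S L]
    [IsScalarTower R K L] (hπ : Irreducible (algebraMap R S ϖ)) (hS : P S)
    (x : Spec (.of L) ⟶ E.left) (hx : x ≫ E.hom = Spec.map (CommRingCat.ofHom (algebraMap K L))) :
    ∃ (s : Fin (M.n + 1)) (j : (𝒞 s).ι)
      (b : (MvPolynomial (Fin ((𝒞 s).N' j)) R ⧸ (𝒞 s).I' j) →ₐ[R] S),
      Spec.map (CommRingCat.ofHom (algebraMap S L)) ≫
          Spec.map (CommRingCat.ofHom (b.comp ((𝒞 s).path j).map).toRingHom) ≫ M.chart s =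
            x ≫ M.gen := by
  obtain ⟨s, a, ha⟩ := M.exists_algHom_of_point (O := S) x hx
  obtain ⟨j, b, hb⟩ := (𝒞 s).lift S hπ hS a
  have hcomp : b.comp ((𝒞 s).path j).map = a := AlgHom.ext hb
  exact ⟨s, j, b, by rw [hcomp]; exact ha⟩

include hϖ in
/-- **The weak Néron property with values in the charts as schemes, for a class of test
rings** (`exists_pathOver_point` for `SmoothChartsP`). [cite: Artin1986NeronModels, Lemma (3.6) (p. 225)] -/
theorem exists_pathOver_pointP (P : TestClass R) [IsIntegral E.left] [Smooth E.hom]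
    (𝒞 : ∀ s : Fin (M.n + 1), SmoothChartsP R P ϖ (M.chartIdeal s))
    {S L : Type u} [CommRing S] [IsDomain S] [IsDiscreteValuationRing S] [Field L] [Algebra S L]
    [IsFractionRing S L] [Algebra R S] [Algebra K L] [Algebra R L] [IsScalarTower R S L]
    [IsScalarTower R K L] (hπ : Irreducible (algebraMap R S ϖ)) (hS : P S)
    (x : Spec (.of L) ⟶ E.left) (hx : x ≫ E.hom = Spec.map (CommRingCat.ofHom (algebraMap K L))) :
    ∃ (s : Fin (M.n + 1)) (j : (𝒞 s).ι) (x' : Spec (.of S) ⟶ (M.pathOver s ((𝒞 s).path j)).left)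
      (xL : Spec (.of L) ⟶ Spec (.of (forestGenRing M s ((𝒞 s).path j)))),
      x' ≫ (M.pathOver s ((𝒞 s).path j)).hom = Spec.map (CommRingCat.ofHom (algebraMap R S)) ∧
      xL ≫ Spec.map (CommRingCat.ofHom
          (algebraMap (forestRing M s ((𝒞 s).path j)) (forestGenRing M s ((𝒞 s).path j)))) =
        Spec.map (CommRingCat.ofHom (algebraMap S L)) ≫ x' ∧
      xL ≫ M.pathGenToE hϖ s ((𝒞 s).path j) = x := by
  obtain ⟨s, j, b, hb⟩ := M.exists_smoothChart_lift_of_pointP P 𝒞 hπ hS x hx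
  let p := (𝒞 s).path j
  let B := forestRing M s p
  -- the `S`-valued point
  let x' : Spec (.of S) ⟶ Spec (.of B) := Spec.map (CommRingCat.ofHom b.toRingHom)
  have hx' : x' ≫ Spec.map (CommRingCat.ofHom (algebraMap R B)) =
      Spec.map (CommRingCat.ofHom (algebraMap R S)) := by
    change Spec.map _ ≫ Spec.map _ = _
    rw [← Spec.map_comp, ← CommRingCat.ofHom_comp]
    congr 2
    exact RingHom.ext fun r => b.commutes r
  -- its generic fibre: `ϖ` is invertible in `L`
  have hunit : ∀ y : Submonoid.powers (algebraMap R B ϖ), IsUnit (((algebraMap S L).comp b.toRingHom) y) := by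
    rintro ⟨_, n, rfl⟩
    rw [map_pow]
    refine IsUnit.pow n ?_
    change IsUnit (algebraMap S L (b (algebraMap R B ϖ)))
    rw [AlgHom.commutes]
    exact isUnit_iff_ne_zero.mpr ((IsFractionRing.to_map_eq_zero_iff (R := S) (K := L)).not.mpr hπ.ne_zero)
  let bL : forestGenRing M s p →+* L :=
    IsLocalization.lift (M := Submonoid.powers (algebraMap R B ϖ)) (S := forestGenRing M s p) hunit
  have hbL : bL.comp (algebraMap B (forestGenRing M s p)) = (algebraMap S L).comp b.toRingHom :=
    IsLocalization.lift_comp (M := Submonoid.powers (algebraMap R B ϖ)) hunit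
  let xL : Spec (.of L) ⟶ Spec (.of (forestGenRing M s p)) := Spec.map (CommRingCat.ofHom bL)
  have hxL : xL ≫ Spec.map (CommRingCat.ofHom (algebraMap B (forestGenRing M s p))) =
      Spec.map (CommRingCat.ofHom (algebraMap S L)) ≫ x' := by
    change Spec.map _ ≫ Spec.map _ = Spec.map _ ≫ Spec.map _
    rw [← Spec.map_comp, ← Spec.map_comp, ← CommRingCat.ofHom_comp, ← CommRingCat.ofHom_comp, hbL]
  have hfin : xL ≫ M.pathGenToE hϖ s p = x := by
    -- equality in `E`: compare in `P`, `E → P` being a monomorphism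
    haveI := M.isOpenImmersion_gen hϖ
    have h2 : x' ≫ Spec.map (CommRingCat.ofHom p.map.toRingHom) =
        Spec.map (CommRingCat.ofHom (b.comp p.map).toRingHom) := by
      change Spec.map _ ≫ Spec.map _ = _
      rw [← Spec.map_comp]
      rfl
    rw [← cancel_mono M.gen, Category.assoc, pathGenToE_gen, ← Category.assoc, hxL, ← hb,
      Category.assoc, ← h2, Category.assoc]
  exact ⟨s, j, x', xL, hx', hxL, hfin⟩

end ProjectiveModel

/-! ### Abelian varieties -/

section Abelian

variable (R K : Type u) [CommRing R] [IsDomain R] [IsDiscreteValuationRing R] [Field K] [Algebra R K]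
  [IsFractionRing R K] (E : Over (Spec (.of K))) [GrpObj E] [IsProper E.hom] [GeometricallyIntegral E.hom]

/-- **Weak Néron models of abelian varieties over an arbitrary discrete valuation ring, for the
admissible test rings** (BLR 3.5 with 3.6): a projective model whose charts admit smooth charts
capturing the admissible points, and the lifting of every `L`-valued point of `E` with
`L = Frac S`, `S` an admissible discrete valuation ring over `R` in which `ϖ` is a uniformizer.
[cite: Artin1986NeronModels, Lemma (3.6) (p. 225)] -/
theorem exists_smoothWeakNeronCharts_adm {ϖ : R} (hϖ : Irreducible ϖ) :
    ∃ M : ProjectiveModel R K E,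
      (∀ s, Nonempty (SmoothChartsP R (AdmClass (IsLocalRing.residue R)) ϖ (M.chartIdeal s))) ∧
      ∀ (𝒞 : ∀ s : Fin (M.n + 1), SmoothChartsP R (AdmClass (IsLocalRing.residue R)) ϖ (M.chartIdeal s))
        (S L : Type u) [CommRing S] [IsDomain S] [IsDiscreteValuationRing S] [Field L] [Algebra S L]
        [IsFractionRing S L] [Algebra R S] [Algebra K L] [Algebra R L] [IsScalarTower R S L]
        [IsScalarTower R K L], Irreducible (algebraMap R S ϖ) → AdmClass (IsLocalRing.residue R) S →
        ∀ (x : Spec (.of L) ⟶ E.left), x ≫ E.hom = Spec.map (CommRingCat.ofHom (algebraMap K L)) →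
          ∃ (s : Fin (M.n + 1)) (j : (𝒞 s).ι)
            (b : (MvPolynomial (Fin ((𝒞 s).N' j)) R ⧸ (𝒞 s).I' j) →ₐ[R] S),
            Spec.map (CommRingCat.ofHom (algebraMap S L)) ≫
                Spec.map (CommRingCat.ofHom (b.comp ((𝒞 s).path j).map).toRingHom) ≫ M.chart s =
                  x ≫ M.gen := by
  obtain ⟨M⟩ := nonempty_projectiveModel_of_grpObj R K E
  haveI : Smooth E.hom := AbelianVariety.smooth_hom (toAbelianVariety K E)
  haveI : IsIntegral E.left := GeometricallyIntegral.isIntegral_of_subsingleton E.hom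
  exact ⟨M, fun s => M.nonempty_smoothCharts_adm hϖ s, fun 𝒞 S L _ _ _ _ _ _ _ _ _ _ _ hπ hS x hx =>
    M.exists_smoothChart_lift_of_pointP _ 𝒞 hπ hS x hx⟩

end Abelian

end Literature.AlgebraicGeometry.Smoothening

end
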